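import Summits.QuantumFields.YangMills.Theorems.BalabanUVNodesC44IterMhFamily
import Summits.QuantumFields.YangMills.Theorems.BalabanUVNodesProp4ColumnsAtRecord
import Literature.MathematicalPhysics.QuantumFieldTheory.Balaban1983to89.B10StarCount
import HarnessLib

/-!
# [B11] PROP. 4 AT THE RECORD — THE TWO-BLOCK CONE OF A COARSE BOND AND THE COLUMN COUNT `2d`: the one-bond coarse-column letter (KL-C) of ✓`…Prop4ColumnsAtRecord`
# reduced to [B7] Prop. 5 (157)'s PER-ENTRY shape «|(δ∕δA_b)C_k(U₀, A, c)| ≦ C₃|A|» ON THE CONE (off the cone the entry is `0` by F9)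

Cell `pub-ymgap` ∕ `ym-nodeO-ideate`, porter lineage `ymgap-nodeO-port-PTB-1` (gen 8); PORT-PLAN-v6 §F9∕§G1 sequel (structural half of (KL-C); ★★★ №583: the estimate itself — [B7] Prop. 5 for
the record's averaging — is a located, unowned dictionary row, NOT proved here).  `--kind proof --supports stmt-QuantumFields-27238 --as helper`; count-neutral.
[B11] = [Balaban1985Variational]; [B7] = [Balaban1985Averaging]; [RG1] = [Balaban1987RG1].

THE PRINT.  [B7] p.24: «Ū^k_c, c ⊂ Ω^{(k)}, depends only on the bond variables U_b for b ⊂ B^k(c₋) ∪ B^k(c₊)»; Prop. 5 (157) p.42: «|(δ∕δA_b)C_k(U₀, A, c)| ≦ C₃|A|» with (138)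
«the functional derivative coincides with partial derivatives … multiplied by η^{−d}»; [B11] (73) p.289, (86)–(88) p.291.

WHAT THIS FILE PROVES (0 def; the cone is the inline region `{x | B^k(x) = c₋ ∨ B^k(x) = c₊}`, `B^k = B14.Eq22Determines.blockIter k`):
§1 `blockIter_toFine_eq_blockIter_toFine_succ_blockOf` (the `k`-block of `toFine i s` is that of `toFine (i+1) (blockOf s)`, `i < k ≤ m + K`), `cone_saturated` (the cone is saturated below `k` —
   lit's `hY`), `mem_bondsIn_cone_self` (`c ∈ bondsIn k (cone c)`), ★ `card_filter_mem_bondsIn_cone_le` (a fine bond lies in the cones of AT MOST `2d` coarse bonds: `c = ⟨z, μ⟩` or `⟨z − e_μ, μ⟩`,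
   `z = B^k(b₋)`), `sum_indicator_cone_le` (`Σ_c g₀·𝟙[b ∈ cone c] ≤ 2d·g₀`).
§2 ★★ `kernelLetterC_of_cone` — (KL-C) in G1's binder shape (`gC := g₀·𝟙[cone]`, `G := 2d·g₀`) FROM the per-entry ON-CONE bound `‖(D C^{𝔰𝔩}(A)·δ_b X)(c)‖ ≤ g₀‖A‖‖X‖` (`b` in the cone of `c`)
   — off the cone the entry vanishes by F9 ✓`equiv_fderiv_CslOfRecord_single_eq_zero`.
§3 ★★★ `prop4UniformAtRecord_node00_of_coneLetter` — G1's door ✓`prop4UniformAtRecord_node00_of_kernelLetters` with (KL-C) := §2: PROP. 4 (97)–(98) at the record (node-00, `0 < k ≤ m + K`) from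
   (ℓa-H) + (KL-H) + (KL-N) + the ON-CONE ENTRY LETTER `g₀` (window `2r·Θ_H·2d·g₀ ≤ ½`, i.e. `g₀` of order `η^d` — exactly [B7] (157)'s `C₃η^d`) + print's (14) + `‖J‖ ≤ nJ`.

HONEST FRAMING.  Lattice bookkeeping + F9; NO estimate.  The on-cone entry letter `g₀ ~ C₃η^d‖·‖` IS [B7] Prop. 5 (157) for the RECORD's (0.4) averaging (lit: corner-block ℤ^d model only,
✓`B7Prop5General.prop5_general_157`) — DISPLAYED, unowned (№583); (ℓa-H), (KL-H), (KL-N) (R1)-class, DISPLAYED; (ℓa-C) only for Ω_j = T (+ F10's nested edition); (R1)∕(R2) OPEN; K0ᴬ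
⟨stmt-QuantumFields-27238⟩ NOT closed; K0ᴬ∕K1ᴬ∕K3ᴬ 0∕3; NODE O 0∕1; COUNT 8∕28 · K 1∕4 UNMOVED; finite `𝕋⁴_{L^K}` at fixed ε — NOT continuum ∕ ℝ⁴ ∕ OS; **the Yang–Mills mass gap (Clay) is NOT
proved by any of this.**  No `sorry`, `instance`, `notation`, `set_option`; standard axioms.
-/

noncomputable section

open scoped Matrix Matrix.Norms.L2Operator InnerProductSpace ComplexConjugate Topology BigOperators
open Classical

namespace Summit.QuantumFields.YangMills.Theorems.C44IterMh

open Literature.MathematicalPhysics.QuantumFieldTheory.Balaban1983to89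
open Literature.MathematicalPhysics.QuantumFieldTheory.Balaban1983to89.Node00
open T4Continuum BlockAveraging
open B10Eq42TorusConstraint (bondsIn mem_bondsIn_iff)
open B10Eq38TorusDomains (toFine toFine_zero)
open B10StarCount (unshift_shift)
open B9SectCLatticeCarrier (Bond)
open B11Eq103H1Complex (SiteL2K)
open B11Eq115Space (NegSup NegSize levWeight)
open B11Eq90Transpose (single115)
open B11Eq90V0primeCurrent (flat115)
open B11Eq111FrakG (nabla115)
open Summit.QuantumFields.YangMills.Theorems.Prop4UniformAtRecord (prop4UniformAtRecord_node00_of_kernelLetters)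

/-! ## §1  The two-block cone of a coarse bond: saturation, membership, and the column count `2d` -/

section Cone

variable {P : Params}

/-- **THE `k`-BLOCK OF A FINE REPRESENTATIVE DOES NOT SEE THE LEVEL IT IS READ AT**: for `i < k ≤ m + K` and `s ∈ T^{(i)}`, `B^k(toFine i s) = B^k(toFine (i+1) (blockOf s))`
(both are the `(k−i)`-fold block of `s`; ✓`Node00.blockIter_toFine`). [cite: Balaban1987RG1, (0.1) p.251 (bookkeeping)] -/
theorem blockIter_toFine_eq_blockIter_toFine_succ_blockOf {i k : ℕ} (hik : i < k) (hk : k ≤ P.m + P.K) (s : Site P i) :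
    B14.Eq22Determines.blockIter k (toFine i s) = B14.Eq22Determines.blockIter k (toFine (i + 1) (blockOf s)) := by
  obtain ⟨n, rfl⟩ : ∃ n, k = i + 1 + n := ⟨k - (i + 1), by omega⟩
  have hi1 : i + 1 ≤ P.m + P.K := by omega
  induction n with
  | zero =>
    show blockOf (B14.Eq22Determines.blockIter i (toFine i s)) = B14.Eq22Determines.blockIter (i + 1) (toFine (i + 1) (blockOf s))
    rw [blockIter_toFine i (by omega) s, blockIter_toFine (i + 1) hi1 (blockOf s)]
  | succ n ih =>
    show blockOf (B14.Eq22Determines.blockIter (i + 1 + n) (toFine i s)) = blockOf (B14.Eq22Determines.blockIter (i + 1 + n) (toFine (i + 1) (blockOf s)))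
    rw [ih (by omega) (by omega)]

/-- **THE TWO-BLOCK CONE `{x | B^k(x) ∈ {c₋, c₊}}` IS SATURATED BELOW `k`** (lit's displayed `hY` of ✓`B15AveragingHolomorphicLocal` ∕ F9 ∕ F10).
[cite: Balaban1985Averaging, p.24; Balaban1987RG1, (0.1) p.251] -/
theorem cone_saturated {k : ℕ} (hk : k ≤ P.m + P.K) (c : PBond P k) :
    ∀ i, i < k → ∀ s : Site P i,
      toFine i s ∈ {x : Site P 0 | B14.Eq22Determines.blockIter k x = c.src ∨ B14.Eq22Determines.blockIter k x = c.tgt} ↔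
        toFine (i + 1) (blockOf s) ∈ {x : Site P 0 | B14.Eq22Determines.blockIter k x = c.src ∨ B14.Eq22Determines.blockIter k x = c.tgt} := by
  intro i hi s
  simp only [Set.mem_setOf_eq, blockIter_toFine_eq_blockIter_toFine_succ_blockOf hi hk s]

/-- The coarse bond lies in (the level-`k` bonds of) its own cone. [cite: Balaban1985Averaging, p.24 (bookkeeping)] -/
theorem mem_bondsIn_cone_self {k : ℕ} (hk : k ≤ P.m + P.K) (c : PBond P k) :
    c ∈ bondsIn k {x : Site P 0 | B14.Eq22Determines.blockIter k x = c.src ∨ B14.Eq22Determines.blockIter k x = c.tgt} := by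
  rw [mem_bondsIn_iff]
  exact ⟨Or.inl (blockIter_toFine k hk c.src), Or.inr (blockIter_toFine k hk c.tgt)⟩

/-- ★ **A FINE BOND LIES IN THE CONES OF AT MOST `2d` COARSE BONDS**: if `b ∈ bondsIn 0 (cone c)` then `B^k(b₋) ∈ {c₋, c₊}`, so `c = ⟨z, μ⟩` or `c = ⟨z − e_μ, μ⟩` with `z = B^k(b₋)`,
`μ ∈ {1, …, d}` — the column of the coarse-indexed one-bond letter has at most `2d` non-zero entries. [cite: Balaban1985Averaging, p.24, (141) p.39; Balaban1985Variational, (73) p.289] -/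
theorem card_filter_mem_bondsIn_cone_le {k : ℕ} (b : PBond P 0) :
    (Finset.univ.filter fun c : PBond P k => b ∈ bondsIn 0 {x : Site P 0 | B14.Eq22Determines.blockIter k x = c.src ∨ B14.Eq22Determines.blockIter k x = c.tgt}).card ≤ 2 * P.d := by
  set z : Site P k := B14.Eq22Determines.blockIter k b.src with hz
  set f : Fin P.d × Bool → PBond P k := fun p => if p.2 then ⟨z, p.1⟩ else ⟨z.unshift p.1, p.1⟩ with hf
  have hsub : (Finset.univ.filter fun c : PBond P k => b ∈ bondsIn 0 {x : Site P 0 | B14.Eq22Determines.blockIter k x = c.src ∨ B14.Eq22Determines.blockIter k x = c.tgt})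
      ⊆ Finset.univ.image f := by
    intro c hc
    rw [Finset.mem_filter] at hc
    obtain ⟨-, hmem⟩ := hc
    rw [mem_bondsIn_iff] at hmem
    obtain ⟨h1, -⟩ := hmem
    simp only [Set.mem_setOf_eq, toFine_zero] at h1
    rw [Finset.mem_image]
    rcases h1 with h | h
    · refine ⟨(c.dir, true), Finset.mem_univ _, ?_⟩
      simp only [hf, if_true, hz, h]
    · refine ⟨(c.dir, false), Finset.mem_univ _, ?_⟩
      have hsrc : z.unshift c.dir = c.src := by rw [hz, h]; exact unshift_shift c.src c.dir
      simp only [hf, Bool.false_eq_true, if_false, hsrc]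
  calc _ ≤ (Finset.univ.image f).card := Finset.card_le_card hsub
    _ ≤ (Finset.univ : Finset (Fin P.d × Bool)).card := Finset.card_image_le
    _ = 2 * P.d := by rw [Finset.card_univ, Fintype.card_prod, Fintype.card_fin, Fintype.card_bool, mul_comm]

/-- **THE COLUMN SUM OF THE CONE INDICATOR**: `Σ_c g₀·𝟙[b ∈ cone c] ≤ 2d·g₀` (`0 ≤ g₀`). [cite: Balaban1985Averaging, (141) p.39 (bookkeeping)] -/
theorem sum_indicator_cone_le {k : ℕ} (b : PBond P 0) {g₀ : ℝ} (hg₀ : 0 ≤ g₀) :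
    (∑ c : PBond P k, if b ∈ bondsIn 0 {x : Site P 0 | B14.Eq22Determines.blockIter k x = c.src ∨ B14.Eq22Determines.blockIter k x = c.tgt} then g₀ else 0) ≤ 2 * (P.d : ℝ) * g₀ := by
  rw [← Finset.sum_filter, Finset.sum_const, nsmul_eq_mul]
  have h := card_filter_mem_bondsIn_cone_le (k := k) b
  have h' : ((Finset.univ.filter fun c : PBond P k => b ∈ bondsIn 0 {x : Site P 0 | B14.Eq22Determines.blockIter k x = c.src ∨ B14.Eq22Determines.blockIter k x = c.tgt}).card : ℝ) ≤ 2 * (P.d : ℝ) := by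
    exact_mod_cast h
  nlinarith

end Cone

/-! ## §2  (KL-C) from the per-entry on-cone letter -/

section Record

variable (F : T4Family) (N : ℕ) [NeZero N] (K k : ℕ) (Ω : ℕ → Set (Site (F.P K) 0)) (U₀ : GaugeField (F.P K) 0 (SU N))
variable [Fact (0 < (F.L : ℝ))] [Fact (0 < (F.P K).eta k)]

/-- ★★ **(KL-C) IN G1's BINDER SHAPE FROM [B7] (157)'s PER-ENTRY SHAPE**: under the guard below `k ≤ m + K`, if on a ball `‖A‖ < ρ` the entries of the derivative kernel of `C^{𝔰𝔩}` satisfy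
`‖(D C^{𝔰𝔩}(A)·δ_b X)(c)‖ ≤ g₀‖A‖‖X‖` whenever `b` lies in the two-block cone of `c`, then G1's one-bond coarse-column letter holds with `gC(c, b) := g₀·𝟙[b ∈ cone c]` (off the cone the entry is `0`,
F9) and `Σ_c gC(c, b) ≤ 2d·g₀`. [cite: Balaban1985Averaging, Proposition 5 (157) p.42, p.24; Balaban1985Variational, (73) p.289, (86) p.291] -/
theorem kernelLetterC_of_cone (hk : k ≤ (F.P K).m + (F.P K).K) (levB : PBond (F.P K) k → ℕ) (hU₀ : SmallBelow (avOfRecord F N K) k U₀) {ρ g₀ : ℝ} (hg₀ : 0 ≤ g₀)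
    (hg : ∀ A : Space115Lit F N K k Ω U₀, ‖A‖ < ρ → ∀ (bb : Bond (F.P K).d (fun _ => (F.P K).sitesPerDir 0)) (X : Matrix (Fin N) (Fin N) ℂ) (c : PBond (F.P K) k),
      (bondToLit (F.P K) 0).symm bb ∈ bondsIn 0 {x : Site (F.P K) 0 | B14.Eq22Determines.blockIter k x = c.src ∨ B14.Eq22Determines.blockIter k x = c.tgt} →
      ‖NegSup.equiv (levWeight (F.L : ℝ) ((F.P K).eta k) levB 0) (Matrix (Fin N) (Fin N) ℂ)
        (fderiv ℂ (CslOfRecord F N K k Ω U₀ levB) A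
          (single115 (lev₁ := pairLevLit F Ω k) (Dc := nabla115 ((F.P K).eta k) (unitsOfRecord F N U₀)) bb X)) c‖ ≤ g₀ * ‖A‖ * ‖X‖) :
    (∀ (c : PBond (F.P K) k) (bb : Bond (F.P K).d (fun _ => (F.P K).sitesPerDir 0)),
      0 ≤ (if (bondToLit (F.P K) 0).symm bb ∈ bondsIn 0 {x : Site (F.P K) 0 | B14.Eq22Determines.blockIter k x = c.src ∨ B14.Eq22Determines.blockIter k x = c.tgt} then g₀ else 0)) ∧
    (∀ A : Space115Lit F N K k Ω U₀, ‖A‖ < ρ → ∀ (bb : Bond (F.P K).d (fun _ => (F.P K).sitesPerDir 0)) (X : Matrix (Fin N) (Fin N) ℂ) (c : PBond (F.P K) k),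
      ‖NegSup.equiv (levWeight (F.L : ℝ) ((F.P K).eta k) levB 0) (Matrix (Fin N) (Fin N) ℂ)
        (fderiv ℂ (CslOfRecord F N K k Ω U₀ levB) A
          (single115 (lev₁ := pairLevLit F Ω k) (Dc := nabla115 ((F.P K).eta k) (unitsOfRecord F N U₀)) bb X)) c‖ ≤
        (if (bondToLit (F.P K) 0).symm bb ∈ bondsIn 0 {x : Site (F.P K) 0 | B14.Eq22Determines.blockIter k x = c.src ∨ B14.Eq22Determines.blockIter k x = c.tgt} then g₀ else 0) * ‖A‖ * ‖X‖) ∧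
    (∀ bb : Bond (F.P K).d (fun _ => (F.P K).sitesPerDir 0),
      (∑ c : PBond (F.P K) k, (if (bondToLit (F.P K) 0).symm bb ∈ bondsIn 0 {x : Site (F.P K) 0 | B14.Eq22Determines.blockIter k x = c.src ∨ B14.Eq22Determines.blockIter k x = c.tgt} then g₀ else 0))
        ≤ 2 * ((F.P K).d : ℝ) * g₀) := by
  refine ⟨fun c bb => by split_ifs <;> [exact hg₀; exact le_rfl], fun A hA bb X c => ?_, fun bb => sum_indicator_cone_le _ hg₀⟩
  by_cases hmem : (bondToLit (F.P K) 0).symm bb ∈ bondsIn 0 {x : Site (F.P K) 0 | B14.Eq22Determines.blockIter k x = c.src ∨ B14.Eq22Determines.blockIter k x = c.tgt}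
  · rw [if_pos hmem]; exact hg A hA bb X c hmem
  · rw [if_neg hmem, zero_mul, zero_mul,
      equiv_fderiv_CslOfRecord_single_eq_zero F N k Ω U₀ hk levB hU₀ (cone_saturated hk c) (mem_bondsIn_cone_self hk c) hmem A X, norm_zero]

/-! ## §3  Prop. 4 at the record (node-00) from (ℓa-H) + (KL-H) + (KL-N) + the on-cone entry letter + (14) -/

/-- ★★★ **[B11] PROP. 4 (97)–(98) AT THE RECORD IN THE NODE-00 REGIME FROM (ℓa-H) + (KL-H) + (KL-N) + THE ON-CONE ENTRY LETTER OF `D C^{𝔰𝔩}` + PRINT's (14)** (`0 < k ≤ m + K`, every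
site in `Ω_k`): G1's door ✓`prop4UniformAtRecord_node00_of_kernelLetters` with its (KL-C) block supplied by §2 from the PER-ENTRY letter «`‖(D C^{𝔰𝔩}(A)·δ_b X)(c)‖ ≤ g₀‖A‖‖X‖` for `b` in
the two-block cone of `c`, `‖A‖ < 2r`» ([B7] (157)'s shape, `g₀` playing `C₃η^d`) and the window `2r·Θ_H·(2d·g₀) ≤ ½`; `G := 2d·g₀` inside the `θ`'s.  Every constant a closed term.
HONEST: glue; the entry letter `g₀`, (ℓa-H), (KL-H), (KL-N) are DISPLAYED, not proved. [cite: Balaban1985Variational, Prop. 4 (97)–(98) pp.292–293, (14) p.280, (73) p.289, (86)–(89) p.291; Balaban1985Averaging, Proposition 5 (157) p.42, p.24; Balaban1985BackgroundPropagators, (3.132) p.422] -/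
theorem prop4UniformAtRecord_node00_of_coneLetter [Fact (0 < c0Rec F K k)] [Fact (∀ c, 0 < wBRec F K k c)] [DecidableEq (PBond (F.P K) k)]
    (levB : PBond (F.P K) k → ℕ) (a : ℝ)
    (hpos : ∀ x, x ≠ 0 → 0 < RCLike.re ⟪x, laplaceAOfRecord F N k U₀ (QOfRecord F N k U₀) (QflatOfRecord F N k) a x⟫_ℂ)
    (hQ : Function.Surjective (QOfRecord F N k U₀))
    (Gp : SiteL2K ℂ (F.P K).d (fun _ => (F.P K).sitesPerDir 0) (c0Rec F K k) (WRec N) →ₗ[ℂ]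
      SiteL2K ℂ (F.P K).d (fun _ => (F.P K).sitesPerDir 0) (c0Rec F K k) (WRec N))
    {b α nJ : ℝ} (hkpos : 0 < k) (hkm : k ≤ (F.P K).m + (F.P K).K) (hb : 0 ≤ b) (hΩ : ∀ x, x ∈ Ω k) (hα0 : 0 ≤ α) (hα : α * (11000000 * N) ≤ 1)
    (hreg : ∀ j, j < k → PlaqSmall (α * ((F.L : ℝ) ^ j * (F.P K).eta k) ^ 2) (Averaging.iter (avOfRecord F N K) j U₀))
    (hH : Prop4LetterHAtRecord F N K k Ω U₀ levB a hpos hQ b)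
    -- (KL-H)
    {hk : Bond (F.P K).d (fun _ => (F.P K).sitesPerDir 0) → PBond (F.P K) k → ℝ} (hk0 : ∀ b' y, 0 ≤ hk b' y)
    (hHk : ∀ (y : PBond (F.P K) k) (Z : Matrix (Fin N) (Fin N) ℂ) (b' : Bond (F.P K).d (fun _ => (F.P K).sitesPerDir 0)),
      ‖flat115 (H1OfRecordAtBgFlat F N K k Ω U₀ levB a hpos hQ
          ((NegSup.equiv (levWeight (F.L : ℝ) ((F.P K).eta k) levB 0) (Matrix (Fin N) (Fin N) ℂ)).symm (Pi.single y Z))) b'‖ ≤ hk b' y * ‖Z‖)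
    {ΘH : ℝ} (hΘH : 0 ≤ ΘH) (hH1 : ∀ y, ∑ b', hk b' y ≤ ΘH) {ΘHw : ℝ} (hΘHw : 0 ≤ ΘHw)
    (hHw : ∀ (bb : Bond (F.P K).d (fun _ => (F.P K).sitesPerDir 0)) (y : PBond (F.P K) k),
      ∑ b', levWeight (F.L : ℝ) ((F.P K).eta k) (bondLevLit F Ω k) 3 bb / levWeight (F.L : ℝ) ((F.P K).eta k) (bondLevLit F Ω k) 3 b' * hk b' y ≤ ΘHw)
    -- the ON-CONE ENTRY LETTER of `D C^{sl}` ([B7] (157)'s shape) on `‖A‖ < 2r`, and the window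
    {g₀ : ℝ} (hg₀ : 0 ≤ g₀)
    (hg : letI C₂ : ℝ := 12800000000000000 * (F.L : ℝ) * N
      letI c₄ : ℝ := 1 / (200000000000 * (F.L : ℝ) * N)
      letI r : ℝ := min (c₄ / 4) (min (1 / 2) (1 / (16 * (b * C₂ + 1))))
      ∀ A : Space115Lit F N K k Ω U₀, ‖A‖ < r + r → ∀ (bb : Bond (F.P K).d (fun _ => (F.P K).sitesPerDir 0)) (X : Matrix (Fin N) (Fin N) ℂ) (c : PBond (F.P K) k),
      (bondToLit (F.P K) 0).symm bb ∈ bondsIn 0 {x : Site (F.P K) 0 | B14.Eq22Determines.blockIter k x = c.src ∨ B14.Eq22Determines.blockIter k x = c.tgt} →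
      ‖NegSup.equiv (levWeight (F.L : ℝ) ((F.P K).eta k) levB 0) (Matrix (Fin N) (Fin N) ℂ)
        (fderiv ℂ (CslOfRecord F N K k Ω U₀ levB) A
          (single115 (lev₁ := pairLevLit F Ω k) (Dc := nabla115 ((F.P K).eta k) (unitsOfRecord F N U₀)) bb X)) c‖ ≤ g₀ * ‖A‖ * ‖X‖)
    (hq : letI C₂ : ℝ := 12800000000000000 * (F.L : ℝ) * N
      letI c₄ : ℝ := 1 / (200000000000 * (F.L : ℝ) * N)
      letI r : ℝ := min (c₄ / 4) (min (1 / 2) (1 / (16 * (b * C₂ + 1))))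
      (r + r) * ΘH * (2 * ((F.P K).d : ℝ) * g₀) ≤ 1 / 2)
    -- (KL-N)
    {hk' : Bond (F.P K).d (fun _ => (F.P K).sitesPerDir 0) → PBond (F.P K) k → ℝ} (hk'0 : ∀ b' y, 0 ≤ hk' b' y)
    (hNk : ∀ (y : PBond (F.P K) k) (Z : Matrix (Fin N) (Fin N) ℂ) (b' : Bond (F.P K).d (fun _ => (F.P K).sitesPerDir 0)),
      ‖NegSup.equiv (levWeight (F.L : ℝ) ((F.P K).eta k) (bondLevLit F Ω k) 3) (Matrix (Fin N) (Fin N) ℂ)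
        (DeltaPiCurOfRecord F N K k Ω U₀ Gp (QflatOfRecord F N k) (H1OfRecordAtBgFlat F N K k Ω U₀ levB a hpos hQ
          ((NegSup.equiv (levWeight (F.L : ℝ) ((F.P K).eta k) levB 0) (Matrix (Fin N) (Fin N) ℂ)).symm (Pi.single y Z)))) b'‖ ≤ hk' b' y * ‖Z‖)
    {Θ' : ℝ} (hΘ'0 : 0 ≤ Θ')
    (hΘ' : ∀ (bb : Bond (F.P K).d (fun _ => (F.P K).sitesPerDir 0)) (y : PBond (F.P K) k),
      ∑ b', levWeight (F.L : ℝ) ((F.P K).eta k) (bondLevLit F Ω k) 3 bb / levWeight (F.L : ℝ) ((F.P K).eta k) (bondLevLit F Ω k) 1 b' * hk' b' y ≤ Θ')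
    {N₁ : ℝ} (hN₁0 : 0 ≤ N₁)
    (hN₁ : ∀ b', ∑ y, levWeight (F.L : ℝ) ((F.P K).eta k) (bondLevLit F Ω k) 3 b' / levWeight (F.L : ℝ) ((F.P K).eta k) levB 0 y * hk' b' y ≤ N₁)
    (hJ : ‖JOfRecordAtBg F N K k Ω U₀‖ ≤ nJ) :
    letI C₂ : ℝ := 12800000000000000 * (F.L : ℝ) * N
    letI c₄ : ℝ := 1 / (200000000000 * (F.L : ℝ) * N)
    letI r : ℝ := min (c₄ / 4) (min (1 / 2) (1 / (16 * (b * C₂ + 1))))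
    letI R' : ℝ := min r ((1 - 4 * b * C₂ * (r + r)) * (1 / 16))
    letI CV : ℝ := 1024 * (((F.P K).d - 1 : ℕ) : ℝ) * ((1 : ℝ) * 1) ^ 3 * N * (α * (1 : ℝ) ^ 2 + 1 / 16)
        + (((F.P K).d - 1 : ℕ) : ℝ) * ((1 : ℝ) * 1) ^ 3 * (136 + 2 * ((1 : ℝ) * 1)) * N
    letI G : ℝ := 2 * ((F.P K).d : ℝ) * g₀
    letI θ₃ : ℝ := (2 * (1 / (1 - 4 * b * C₂ * (r + r))) + 1) * ΘHw * G / r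
    letI θE : ℝ := 2 * ΘHw * G * (1 / (1 - 4 * b * C₂ * (r + r)))
    letI θE' : ℝ := 2 * Θ' * G * (1 / (1 - 4 * b * C₂ * (r + r)))
    Prop4UniformAtRecord F N K k Ω U₀ levB a hpos hQ r Gp
      ((N * θ₃ * nJ + (N₁ * C₂ * (1 / (1 - 4 * b * C₂ * (r + r))) ^ 2 + N * θE')
        + N * θE * (N₁ * C₂ * (1 / (1 - 4 * b * C₂ * (r + r))) ^ 2) * R'
        + N * (1 + θE * R') * CV * (1 / (1 - 4 * b * C₂ * (r + r))) ^ 2)) R' := by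
  have hU₀ : SmallBelow (avOfRecord F N K) k U₀ := (loopProfile_of_regular_below F N k U₀ le_rfl hα0 hα hreg).1
  obtain ⟨hgC0, hCg, hG⟩ := kernelLetterC_of_cone F N K k Ω U₀ hkm levB hU₀ hg₀ hg
  have hG0 : 0 ≤ 2 * ((F.P K).d : ℝ) * g₀ := by positivity
  exact prop4UniformAtRecord_node00_of_kernelLetters F N K k Ω U₀ levB a hpos hQ Gp hkpos hb hΩ hα0 hα hreg hH hk0 hHk hΘH hH1 hΘHw hHw hgC0 hCg hG0 hG hq
    hk'0 hNk hΘ'0 hΘ' hN₁0 hN₁ hJ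

end Record

end Summit.QuantumFields.YangMills.Theorems.C44IterMh

end
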